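import Summits.QuantumFields.BalabanUV.T4Continuum.Spine.NE1p.DressedTowerWitnessPairEnd
import Summits.QuantumFields.BalabanUV.T4Continuum.Spine.NE1p.DressedStabilityOfAbsorptionRouteSchedules

/-!
# T⁴ programme, spine estimate NE1′ (node O3b/H2) — THE ℝ-STEP SEAM FIRES AT FUNCTION LEVEL, part 1 of 2 (W30.1): W13's two-family
# function-level datum `towerP` read through a GENUINE `RStep` datum; S3l.1's canonical ℝ-step terminal face and S3t's absorption-route
# face APPLIED BY NAME; ROOT-C OF RECORD `DressedStabilityStrict towerP (128⁴)` (swarm witness «W30» of `t4/formal/NE1p/LEAVES.md`, DAG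
# N29zi; INTENT HOME/CLAIMS.log l.16134, BOOKED typer R-T105 (vii) l.16189, owner GO l.16191) [decided toy]

Cell `pub-balaban`, sub-cell `t4`, BINDER-OWNERS row NE1′ (owner lineage t4-ne1p-p1; ROOT-C OF RECORD `DressedRootStrict.DressedStabilityStrict`
p216910, ROOT-B `DressedRootFam.DressedBudget` p211697, headline `DressedRoot.DressedStability` p211416); formalisation crew
`b2b-balaban-t4-ne1p-formalise-*`, seat `…-leaf-01` (gen 11).  ADDITIVE — imports leaf-04's W13 part 3 `Spine/NE1p/DressedTowerWitnessPairEnd`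
(p216513; through it parts 1–2 p216246 ∕ p216368: the datum `BP` ∕ `TP` ∕ `towerP`, anchoring `anchP`, housing `compP` ∕ `hhousedP` ∕ `hvolP`,
absorption data `SabsP` ∕ `holderP` ∕ `hsubP` ∕ `βP` ∕ `envVar_oldP` and ≈ 50 per-cutoff binder lemmas — ALL BY NAME) and leaf-04's S3t
`Spine/NE1p/DressedStabilityOfAbsorptionRouteSchedules` (p218687; through it leaf-02's S3l.1 `DressedStabilityOfCanonicalRStepSliceWinSchedules`
p215263 and leaf-08's S3s-1 bridge `dressedStabilityStrict_of_cellWith` p217391) ONLY; modifies nothing; nothing of W13 ∕ S3l.1 ∕ S3t ∕ S3s-1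
restated.  Part 2 (W30.2) = `Spine/NE1p/DressedFrozenStepWitness.lean`: S3t's FROZEN corner on a one-family toy with Dirac laws from step 1.

WHY.  The crew's ℝ-step seam — rows S3j (p214839), S3k.1 (p215059), S3l.1 (p215263) and the absorption-route face S3t (p218687) — replaces
the LIVE-FAMILY births door of S3i ∕ S3k ∕ S3l (`Sabs`, `holder`, `hsub`, `habs : AbsorbsFrom`) by row O3.E-iii-c's ONE datum
`Rs a K : T4PreservedUnderR.RStep (𝒯.B a K)` with `hcv : CompVol vR`, `hpre : PreBelowEnv`, `hlaw : AbsorbLaw`, the fan-out pair at the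
DERIVED multiplicity `vR·mB`, and (S3t) the step classification `Spec` ∕ `hBspec` ∕ `hEspec` ∕ `hfrz`.  Before this file NO module applied
any of these faces (`DressedStabilityOfCanonicalRStepSliceWinSchedules` is imported by S3t only, `DressedStabilityOfRStepSliceWinSchedules` by
S3l.1 only, `DressedStabilityOfRStepSchedules` and S3t by nobody — typer-verified, R-T105 (vii)); the one `RStep` inhabitant, leaf-02's W8
`DressedSuppliedWitness` (p214971), is BOOKING-level (END-B's cell door via S5e `hbirth_of_rstep_cell`); every FUNCTION-level terminal-face
witness (W7c ∕ W11 ∕ W11r ∕ W12–W17) fires S3h-2 or S3l through the live-family door.  Non-vacuity of SHAPES (trigger (t5) for these ENDs).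

CONTENTS.
* §1 THE ℝ-STEP DATUM ON W13's BOOKING: `preP K b k := ρ₀·envVar C ρ b (k−1)` (the pre-ℝ size DEFINED as the transported envelope one step
  on — the 𝕋-side half of the seam in its EQUALITY case) and `RsP K : RStep (BP K)` (`absorbs := SabsP K`, `absorbs_lt := holderP`,
  `comp b′ :=` the one cube of the birth scale, `comp_scale := hscaleP`, `absorbs_felt := hhousedP ∘ hsubP`, `δ b′ := βP K j_{b′}`); faces
  `compVol_RsP : CompVol 1` (ATTAINED), `preBelowEnv_RsP` (∀ gate, by `rfl`), `absorbLaw_RsP : AbsorbLaw (RsP K) 2 (βP K) ⅛` (for the young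
  family an EQUALITY, `absorbLaw_RsP_eq`, with `pre false 1 = ρ₀·2·gP K false`), the pair `hfanR` ∕ `hampR` at `vR·mB = 1·2`;
  GENUINENESS `absorbs_RsP_true` (`= {false}`, `K ≥ 1`), `pre_RsP_old_one_pos`, `delta_lt_gen` (W13's `absorption_genuineP` in `RStep` currency).
* §2 S3l.1 FIRES: leaf-02's With-form END `dressedStabilityWith_of_canonicalRStepSliceWinSchedules` applied ONCE BY NAME on `towerP` (≈ 50
  displayed binders by W13's lemmas, the four ℝ-seam slots by §1), read in the consumers' per-cutoff currency as the theorem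
  **`classAt_towerP_rstep : ClassAt (towerP.B p K) 1 (rhoOne 128⁻² 2 0 ½) 128⁻³`** (new statement); the With-form, the headline and ROOT-B
  (S3l.1's budget END applied ONCE BY NAME) are `example`s — their STATEMENTS coincide with W13's landed `dressedStabilityWith_towerP` ∕
  `dressedStability_towerP` ∕ `dressedBudget_towerP` (S3l's live-family door), which the gate's `dedup.landed` protects (W11r precedent,
  `DressedTerminalWitnessReuseEnd`): what is checked is that the ℝ-SEAM face fires on the datum; **ROOT-C OF RECORD
  `dressedStabilityStrict_towerP_rstep : DressedStabilityStrict towerP (128⁴)`** (new for `towerP`) via leaf-08's `dressedStabilityStrict_of_cellWith`.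
* §3 S3t FIRES IN THE SPECTATOR CORNER `Spec :≡ True` (`hBspec` ∕ `hEspec` := W7's `realBaseAt_W` ∕ W12's `exponentSliceAt_M` as in W13; `hfrz`
  VACUOUS HERE — the frozen corner is W30.2's): the With-form END `dressedStabilityWith_of_absorptionRouteSchedules` as an `example` (statement
  = W13's) and S3t's fourth END as the theorem **`dressedStabilityStrict_towerP_route : DressedStabilityStrict towerP ((128:ℝ)^4)`** — the same
  proposition as `dressedStabilityStrict_towerP_rstep`: two routes, one `Prop` (closing `example`).

LIVE vs ≡ 0 (typer R-T56 (h) (2)).  LIVE: everything W13 declares live PLUS the ℝ-seam — `absorbs` non-empty, `pre > 0`, `PreBelowEnv` ∕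
`AbsorbLaw` EQUALITIES, `absorbs_felt` through the housing, `CompVol 1` attained, `hfan = ½ < 1`, `hamp = 1 ≤ A₀ = 1` (equality).  DECLARED
≡ 0 ∕ degenerate: `𝒜 ≡ 0`, `s ≡ 0`, `creg ≡ 0`, `rel = Eq`, `base ≡ 1`, `z₀ = z₁ = 0`, `q ≡ 0` (as in W13), and `Spec :≡ True` (§3).

HONEST FRAMING (typer R-T105 (vii)(g) wording ADOPTED).  A DECIDED TOY ([folklore]; 0 sorry; 0 citations; no `def … : Prop` — the two `def`s
are toy DATA).  `RStep` is row O3.E-iii-c's SHAPE `T4PreservedUnderR.RStep` (a Literature STRUCTURE — our typing of «preserved under 𝐑», not a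
printed theorem), and `preP` is DEFINED as the transported envelope — the seam's EQUALITY case — so this file certifies that the ℝ-seam's
SOCKETS COMPOSE at function level on a decided toy, NOT that an ℝ-operation of [Balaban1989LargeFieldII] (1.65)–(1.79) ∕ pp. 388–391 was
performed or bounded; NOTHING of Bałaban's 𝐑 ∕ 𝐓′ operations, large-field met components or absorption is modelled or asserted; S3t's
SPECTATOR corner only (the frozen corner is W30.2's, frozen BY CONSTRUCTION); `128` = W13's toy integer, a kernel consequence of `locCell`
(k2), never «Bałaban's L»; F-6's rate `ψ = L⁻²` a displayed wall (k3); discharges NO wall item; R-t4r2-Q2 NOT met thereby.  Headline (c4):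
«the ℝ-step seam's function-level faces S3l.1 and S3t FIRE on a decided two-family toy with a genuine `RStep` datum; ROOT-C OF RECORD at
Λ = 128⁴ follows BY NAME; non-vacuity of SHAPES only — NE1′ ⇐ the named binders, NOT proved, NOT printed; 0 binders instantiated on Bałaban's
densities»; spine PROVED 0∕9.  Rung (B)+1 on ONE finite four-torus — NOT infinite volume, NOT a mass gap, NOT OS on ℝ⁴, NOT Clay, NOT
summit progress.  HONEST DEPENDENCY: continuum YM on T⁴ ⇐ BetaPertH ∧ nine spine estimates (0/9 proved); BetaPertH ⇐ (D1) ∧ (D4) ∧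
CAP+tail; G-an2-4 gates asym, D1 and NE2/3/4.
-/

noncomputable section

namespace Summit.QuantumFields.BalabanUV.T4Continuum.NE1p.DressedTowerWitnessPairRStep

open MeasureTheory Set Metric Finset
open scoped BigOperators
open Literature.MathematicalPhysics.QuantumFieldTheory.Balaban1983to89
open Literature.MathematicalPhysics.QuantumFieldTheory.Balaban1983to89.T4TermFormat
open Literature.MathematicalPhysics.QuantumFieldTheory.Balaban1983to89.T4TermFormat.Booking
open Literature.MathematicalPhysics.QuantumFieldTheory.Balaban1983to89.T4FeltGeometry
open Literature.MathematicalPhysics.QuantumFieldTheory.Balaban1983to89.T4GatedBooking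
open Literature.MathematicalPhysics.QuantumFieldTheory.Balaban1983to89.T4TrajectoryComparison
open Literature.MathematicalPhysics.QuantumFieldTheory.Balaban1983to89.T4PreservedUnderR (RStep)
open T4TrajectoryModulus (bondBall bondBall_add_mem bondBall_latMove_add_mem bondBall_diam)
open T4BlockTransport (Fld NDir latMove latN Site norm_dir_le)
open T4BirthChartTransport (GaugeInvariant BirthSlice RelGauge)
open T4TrajectoryDensity
open Summit.QuantumFields.BalabanUV.T4Continuum.T4TrajectoryDensityDressed
open Summit.QuantumFields.BalabanUV.T4Continuum.T4TrajectoryDensityWitness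
open Summit.QuantumFields.BalabanUV.T4Continuum.NE1p.DressedRoot
open Summit.QuantumFields.BalabanUV.T4Continuum.NE1p.DressedUniformConstants
open Summit.QuantumFields.BalabanUV.T4Continuum.NE1p.DressedAbsorptionWindow
open Summit.QuantumFields.BalabanUV.T4Continuum.NE1p.DressedWindowScheduleWin
open Summit.QuantumFields.BalabanUV.T4Continuum.NE1p.DressedWindowScheduleModWin
open Summit.QuantumFields.BalabanUV.T4Continuum.NE1p.DressedTowerWitness
open Summit.QuantumFields.BalabanUV.T4Continuum.NE1p.DressedTowerWitnessSlice (exponentSliceAt_M)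
open Summit.QuantumFields.BalabanUV.T4Continuum.NE1p.DressedAbsorptionWitness (bs bs_le bs_false bs_true)
open Summit.QuantumFields.BalabanUV.T4Continuum.NE1p.DressedTowerWitnessPair
open Summit.QuantumFields.BalabanUV.T4Continuum.NE1p.DressedStabilityOfCanonicalRStepSliceWinSchedules
open Summit.QuantumFields.BalabanUV.T4Continuum.NE1p.DressedStabilityStrictOfCanonicalSliceWinSchedules (dressedStabilityStrict_of_cellWith)
open Summit.QuantumFields.BalabanUV.T4Continuum.NE1p.DressedStabilityOfAbsorptionRouteSchedules

/-! ## §1 The ℝ-step datum on W13's two-family booking [decided toy] -/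

/-- THE PRE-ℝ SIZE [decided toy]: family `b`'s size just before the ℝ-operation of scale `k` := its step-`(k−1)` envelope transported one
step at the cell rate, `ρ₀·envVar C ρ b (k−1)` with `C = 4c_δ∕r = 2`, `ρ₀ = ψ·alphaCell ½` — the 𝕋-side half of the seam
(`PreBelowEnv`) in its EQUALITY case.  DEFINED, not computed from an operation on densities. [folklore] -/
def preP (K : ℕ) (b : Bool) (k : ℕ) : ℝ :=
  rhoP * (TP K).envVar (4 * (1 / 2) / 1) (fun _ : ℕ => ((128 : ℝ) ^ 2)⁻¹ * alphaCell (1 / 2)) b (k - 1)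

/-- Pre-ℝ sizes are nonnegative. [folklore] -/
theorem preP_nonneg (K : ℕ) (b : Bool) (k : ℕ) : 0 ≤ preP K b k :=
  mul_nonneg rhoP_pos.le ((TP K).envVar_nonneg (by norm_num) (fun _ => rhoP_pos.le) b (k - 1))

/-- **THE ℝ-STEP DATUM** [decided toy] — row O3.E-iii-c's shape `RStep (BP K)` ON W13's booking: pre-ℝ sizes `preP`; absorbed families =
W13's `SabsP` (the young family absorbs the old one when it is genuinely younger), strictly older by W13's `holderP`; the renormalised
component at a birth = the ONE cube of the birth scale (W13's `compP`, scales by `hscaleP`); `absorbs_felt` DISCHARGED through W13's housing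
(`hhousedP ∘ hsubP`: the absorbed family is live in, hence felt at, the absorbing family's component); dressing sizes `δ b′ = βP K j_{b′}`.
Nothing of Bałaban's components is modelled. [folklore] -/
def RsP (K : ℕ) : RStep (BP K) where
  pre := preP K
  pre_nonneg := preP_nonneg K
  absorbs := SabsP K
  absorbs_lt := fun b' b h => holderP K b' b h
  comp := fun b' => compP K (bs K b') b'
  comp_scale := fun b' q hq => hscaleP K (bs K b') b' q hq
  absorbs_felt := fun b' b h => hhousedP K (bs K b') b' b (hsubP K b' h)
  δ := fun b' => βP K (bs K b')
  δ_nonneg := fun b' => by unfold βP; positivity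

/-- `hcv` — COMPONENT VOLUME `vR = 1` [folklore]: W13's `hvolP` at the birth scale. -/
theorem compVol_RsP (K : ℕ) : (RsP K).CompVol 1 := fun b' => hvolP K (bs K b') b'

/-- … ATTAINED: every component has exactly one cube (no slack in `vR = 1`). [decided toy] [folklore] -/
theorem compVol_RsP_attained (K : ℕ) (b' : Bool) : ((RsP K).comp b').card = 1 := by
  show (compP K (bs K b') b').card = 1
  unfold compP
  rw [dif_pos (bs_le K b'), Finset.card_singleton]

/-- For `K ≥ 1` the young family GENUINELY absorbs the old one: `absorbs true = {false}`. [decided toy] [folklore] -/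
theorem absorbs_RsP_true {K : ℕ} (hK : 1 ≤ K) : (RsP K).absorbs true = {false} := by
  show SabsP K true = {false}
  unfold SabsP
  rw [if_pos ⟨rfl, hK⟩]

/-- The old family absorbs nobody. [decided toy] [folklore] -/
theorem absorbs_RsP_false (K : ℕ) : (RsP K).absorbs false = ∅ := by
  show SabsP K false = ∅
  unfold SabsP
  rw [if_neg (by simp)]

/-- **`hpre` — PRE-SIZES BELOW THE TRANSPORTED ENVELOPE, AS AN EQUALITY** [decided toy]: `pre b (k+1) = ρ₀·envVar C ρ b k` by the
definition of `preP`, for ANY gate. [folklore] -/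
theorem preBelowEnv_RsP (K : ℕ) (Gate : ℕ → Prop) :
    (TP K).PreBelowEnv (RsP K) (4 * (1 / 2) / 1) (fun _ : ℕ => ((128 : ℝ) ^ 2)⁻¹ * alphaCell (1 / 2)) Gate := by
  intro b k _ _ _
  show preP K b (k + 1) ≤ _
  unfold preP
  rw [Nat.add_sub_cancel]
  rfl

/-- The old family's pre-ℝ size at the young family's birth scale `1`, in closed form: `pre false 1 = ρ₀·(2·gP K false)` (W13's
`envVar_oldP` at `k = 0`). [arith] [folklore] -/
theorem pre_RsP_old_one (K : ℕ) : (RsP K).pre false 1 = rhoP * (4 * (1 / 2) / 1 * gP K false) := by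
  show preP K false 1 = _
  unfold preP
  rw [Nat.sub_self, envVar_oldP, pow_zero, mul_one]

/-- … which is POSITIVE: a genuine mass is handed over at the ℝ-step. [decided toy] [folklore] -/
theorem pre_RsP_old_one_pos (K : ℕ) : 0 < (RsP K).pre false 1 := by
  rw [pre_RsP_old_one]
  have := rhoP_pos; have := gP_pos K false
  positivity

/-- **`hlaw` — THE ABSORPTION LAW WITH `A = ⅛`** [decided toy]: `C·gen b j_b ≤ βP K j_b + ⅛·Σ_{b₀ ∈ absorbs b} pre b₀ j_b` — for the old
family the dressing alone (equality), for the young one (when `K ≥ 1`) dressing PLUS `⅛ ×` the old family's pre-ℝ size at scale `1`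
(equality, `absorbLaw_RsP_eq`).  W13's `habsP` read in the `RStep` currency: `pre false 1 = envVar C ρ false 1`. [folklore] -/
theorem absorbLaw_RsP (K : ℕ) : (TP K).AbsorbLaw (RsP K) (4 * (1 / 2) / 1) (βP K) (1 / 8) := by
  intro b
  change Bool at b
  show 4 * (1 / 2) / 1 * (if bs K b = bs K b then gP K b else 0) ≤
    βP K (bs K b) + 1 / 8 * ∑ b₀ ∈ SabsP K b, preP K b₀ (bs K b)
  rw [if_pos rfl]
  unfold SabsP βP
  by_cases hb : b = true ∧ 1 ≤ K
  · rw [if_pos hb, Finset.sum_singleton]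
    unfold preP
    rw [hb.1, bs_true hb.2, Nat.sub_self, envVar_oldP]
    unfold gP
    rw [bs_true hb.2, bs_false, if_pos ⟨rfl, hb.2⟩, if_neg (by simp), add_zero, Nat.sub_zero, pow_zero, mul_one]
    exact le_of_eq (by ring)
  · rw [if_neg hb, Finset.sum_empty, mul_zero, add_zero]
    unfold gP
    rw [if_neg hb, add_zero]
    exact le_of_eq (by ring)

/-- **THE YOUNG FAMILY's ABSORPTION LAW IS AN EQUALITY** [decided toy]: for `K ≥ 1`,
`C·gen true 1 = βP K 1 + ⅛·Σ_{b₀ ∈ absorbs true} pre b₀ 1` — the absorbed pre-ℝ mass is booked IN FULL at `A = ⅛`. [folklore] -/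
theorem absorbLaw_RsP_eq {K : ℕ} (hK : 1 ≤ K) :
    4 * (1 / 2) / 1 * (TP K).gen true (bs K true) =
      βP K (bs K true) + 1 / 8 * ∑ b₀ ∈ (RsP K).absorbs true, (RsP K).pre b₀ (bs K true) := by
  show 4 * (1 / 2) / 1 * (if bs K true = bs K true then gP K true else 0) =
    βP K (bs K true) + 1 / 8 * ∑ b₀ ∈ SabsP K true, preP K b₀ (bs K true)
  unfold SabsP
  rw [if_pos rfl, if_pos ⟨rfl, hK⟩, Finset.sum_singleton]
  unfold preP βP
  rw [bs_true hK, Nat.sub_self, envVar_oldP]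
  unfold gP
  rw [bs_true hK, bs_false, if_pos ⟨rfl, hK⟩, if_neg (by simp), add_zero, Nat.sub_zero, pow_zero, mul_one]
  ring

/-- **ABSORPTION IS GENUINE IN THE `RStep` CURRENCY** [decided toy]: for `K ≥ 1` the dressing's own size `δ true` is STRICTLY below the
young family's booked birth generation `C·gen true 1` (W13's `absorption_genuineP` BY NAME; `δ true = βP K 1` by `rfl`). [folklore] -/
theorem delta_lt_gen {K : ℕ} (hK : 1 ≤ K) : (RsP K).δ true < 4 * (1 / 2) / 1 * (TP K).gen true (bs K true) :=
  absorption_genuineP hK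

/-- The absorption fan-out at the DERIVED absorbed multiplicity `vR·mB = 1·2`: `⅛·2·(1−½)⁻¹ = ½ < 1`. [arith] [folklore] -/
theorem hfanR : fanout (1 / 8) (((1 : ℕ) : ℝ) * ((2 : ℕ) : ℝ)) (1 / 2) < 1 := by unfold fanout; norm_num

/-- The absorbed amplitude at `vR·mB = 1·2`: `½ ∕ (1 − ½) = 1 ≤ A₀ = 1` (EQUALITY). [arith] [folklore] -/
theorem hampR : absorbAmplitude (1 / 2) (1 / 8) (((1 : ℕ) : ℝ) * ((2 : ℕ) : ℝ)) (1 / 2) ≤ 1 := by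
  unfold absorbAmplitude fanout; norm_num

/-! ## §2 THE CANONICAL ℝ-STEP TERMINAL FACE S3l.1 FIRES on the two-family datum [decided toy] -/

/-- **S3l.1 FIRES — CONSTANTS DISPLAYED** [decided toy]: `DressedStabilityWith towerP 1 (rhoOne 128⁻² 2 0 ½) 128⁻³` by ONE application of
leaf-02's `dressedStabilityWith_of_canonicalRStepSliceWinSchedules` BY NAME, with W13's single cutoff-free schedule `fun _ _ => Wp`, its scalar
set `(κ, L, C, c̄, N₀, A₀, m, s̄⁰, ρ′, A, β₀, v, mB) = (½, 128, 2, 0, 2, 1, ⅛, ½, ½, ⅛, ½, 1, 2)` and `vR = 1`, EVERY displayed binder inhabited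
by W13's per-cutoff lemmas (`hslP`, `FnP_succ`, `hQP`∕`hSgP`, `realBaseAt_W`, `exponentSliceAt_M`, `hδfP`∕`hδfwkP`∕`hdefwkP`∕`hrateP`∕
`hcmP`, `relGauge_pairsP`, `hneP`∕`hsupP`, `hregP`, `anchP`∕`hmultP`∕`hscaleP`∕`hhousedP`∕`hvolP`) and the four ℝ-seam slots by §1 (`RsP`,
`compVol_RsP`, `preBelowEnv_RsP`, `absorbLaw_RsP`) with `hβ` by `le_rfl` and the pair `hfanR`∕`hampR` at `vR·mB`.  An `example`, not a
theorem: the STATEMENT is W13's landed `dressedStabilityWith_towerP` (S3l's live-family door), protected by the gate's `dedup.landed`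
(W11r precedent); the theorem-level reading is `classAt_towerP_rstep` below.  Non-vacuity of the binder SHAPES of S3l.1. [folklore] -/
example : DressedStabilityWith towerP 1 (rhoOne ((128 : ℝ) ^ 2)⁻¹ (4 * (1 / 2) / 1) 0 (1 / 2)) ((128 : ℝ)⁻¹ ^ 3) :=
  dressedStabilityWith_of_canonicalRStepSliceWinSchedules towerP (κ := 1 / 2) (L := 128) (cbar := 0) (N₀ := 2) (A₀ := 1)
    (sbar := 1 / 2) (ρ' := 1 / 2) (r := 1) (cδ := 1 / 2) (m := 1 / 8) (w := fun _ _ => 1) (fun _ _ => Wp) (by norm_num)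
    (Fn := fun _ K f k' k => FnP K f k' k) (rel := fun _ _ _ _ _ U U' => U = U') (ref := fun _ _ _ _ U => U)
    (base := fun _ _ _ _ => base₁) (𝒜 := fun _ _ _ _ => zeroExp) (𝒬 := fun _ K _ k => 𝒬P K k) (q := fun _ _ _ _ _ => 0)
    (μ := fun _ _ _ k => flAt (atomP (k + 1))) (z₀ := fun _ _ _ _ => 0) (z₁ := fun _ _ _ _ => 0)
    (defect := fun _ _ _ _ k => defP (k + 1)) (s := fun _ _ _ _ => 0) (S := fun _ K k b => SP K k b)
    (Sg := fun _ K k b => SgP K k b) (c := fun _ _ _ _ => (((1 / 8 : ℝ)) : ℂ)) (δf := fun _ _ _ k _ => dfP k)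
    (creg := fun _ _ _ => 0) (Lb := 128) (mB := 2) (v := 1) (vR := 1) (fun _ K => anchP K)
    (comp := fun _ K k b => compP K k b) (fun _ K => RsP K) (β := fun _ K j => βP K j) (A := 1 / 8) (β₀ := 1 / 2)
    (fun _ _ => hratioP) hLP le_rfl (by norm_num) zero_le_one (by norm_num) hlocP (by norm_num) hsmallP one_pos (by norm_num)
    (fun _ K b k' _ _ _ => birthSlice_anti_window (hslP K b k') (Wp.hwcw k'))
    (fun _ K f k' k _ _ _ _ U => FnP_succ K f k' k U) (fun _ _ _ _ k _ _ _ _ _ => mem_bddClass_flAt _ _)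
    (fun _ _ _ _ k _ _ _ _ => realBaseAt_W _ _) (fun _ _ _ _ k _ _ _ _ => exponentSliceAt_M _ _ _ _)
    (fun _ _ _ k x _ => hδfP k x.2) (fun _ _ _ k => hDμP k) (fun _ _ _ k => hz₁P k)
    (fun _ _ _ _ k _ _ _ _ U₀ _ pd _ _ => (relGauge_pairsP k).mono fun z hz t _ => hz (latMove U₀ pd t))
    (fun _ _ _ _ _ _ _ h => h ▸ rfl) (fun _ _ _ _ _ k _ => aesm_flAt _ _) (fun _ _ _ _ k => hdefwkP k)
    (fun _ _ _ k' k _ _ _ => hrateP k' k) (fun _ _ b _ k _ _ _ _ => hneP b k) (fun _ K b k' k _ _ _ _ => hsupP K b k' k)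
    (fun _ _ _ => le_rfl) (fun _ _ _ _ => le_rfl) (fun _ K => hregP K _) (fun _ _ _ _ => by norm_num) hLbP
    (fun _ K => hmultP K) (fun _ K => hscaleP K) (fun _ K => hhousedP K) (fun _ K => hvolP K)
    (fun _ K => compVol_RsP K) (fun _ K => preBelowEnv_RsP K _) (fun _ K => absorbLaw_RsP K) (fun _ _ _ _ => le_rfl)
    (fun _ K b k => hQP K b k) (fun _ K => hSgP K) (fun _ _ _ _ => hcmP) (fun _ _ _ k _ _ => hδfwkP k) hvN₀P (by norm_num)
    hfanR hampR

/-- **THE PER-CUTOFF CLASS THROUGH THE ℝ-STEP SEAM, IN THE CONSUMERS' CURRENCY** [decided toy]: at every run parameter and cutoff the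
two-family booking is in the two-rate class `ClassAt (towerP.B p K) 1 (rhoOne 128⁻² 2 0 ½) 128⁻³` (`DressedRoot.ClassAt`, what H3∕U5b
`T4SmallFieldAnalyticity` and `T4PreservedUnderR`∕`T` read per step) — the last conjunct of S3l.1's With-form END applied BY NAME exactly
as in the `example` above (same binders, same ℝ-seam slots).  New statement for `towerP`; the END application lives in THIS proof term.
[folklore] -/
theorem classAt_towerP_rstep (p : Unit) (K : ℕ) :
    ClassAt (towerP.B p K) 1 (rhoOne ((128 : ℝ) ^ 2)⁻¹ (4 * (1 / 2) / 1) 0 (1 / 2)) ((128 : ℝ)⁻¹ ^ 3) :=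
  (dressedStabilityWith_of_canonicalRStepSliceWinSchedules towerP (κ := 1 / 2) (L := 128) (cbar := 0) (N₀ := 2) (A₀ := 1)
      (sbar := 1 / 2) (ρ' := 1 / 2) (r := 1) (cδ := 1 / 2) (m := 1 / 8) (w := fun _ _ => 1) (fun _ _ => Wp) (by norm_num)
      (Fn := fun _ K f k' k => FnP K f k' k) (rel := fun _ _ _ _ _ U U' => U = U') (ref := fun _ _ _ _ U => U)
      (base := fun _ _ _ _ => base₁) (𝒜 := fun _ _ _ _ => zeroExp) (𝒬 := fun _ K _ k => 𝒬P K k) (q := fun _ _ _ _ _ => 0)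
      (μ := fun _ _ _ k => flAt (atomP (k + 1))) (z₀ := fun _ _ _ _ => 0) (z₁ := fun _ _ _ _ => 0)
      (defect := fun _ _ _ _ k => defP (k + 1)) (s := fun _ _ _ _ => 0) (S := fun _ K k b => SP K k b)
      (Sg := fun _ K k b => SgP K k b) (c := fun _ _ _ _ => (((1 / 8 : ℝ)) : ℂ)) (δf := fun _ _ _ k _ => dfP k)
      (creg := fun _ _ _ => 0) (Lb := 128) (mB := 2) (v := 1) (vR := 1) (fun _ K => anchP K)
      (comp := fun _ K k b => compP K k b) (fun _ K => RsP K) (β := fun _ K j => βP K j) (A := 1 / 8) (β₀ := 1 / 2)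
      (fun _ _ => hratioP) hLP le_rfl (by norm_num) zero_le_one (by norm_num) hlocP (by norm_num) hsmallP one_pos (by norm_num)
      (fun _ K b k' _ _ _ => birthSlice_anti_window (hslP K b k') (Wp.hwcw k'))
      (fun _ K f k' k _ _ _ _ U => FnP_succ K f k' k U) (fun _ _ _ _ k _ _ _ _ _ => mem_bddClass_flAt _ _)
      (fun _ _ _ _ k _ _ _ _ => realBaseAt_W _ _) (fun _ _ _ _ k _ _ _ _ => exponentSliceAt_M _ _ _ _)
      (fun _ _ _ k x _ => hδfP k x.2) (fun _ _ _ k => hDμP k) (fun _ _ _ k => hz₁P k)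
      (fun _ _ _ _ k _ _ _ _ U₀ _ pd _ _ => (relGauge_pairsP k).mono fun z hz t _ => hz (latMove U₀ pd t))
      (fun _ _ _ _ _ _ _ h => h ▸ rfl) (fun _ _ _ _ _ k _ => aesm_flAt _ _) (fun _ _ _ _ k => hdefwkP k)
      (fun _ _ _ k' k _ _ _ => hrateP k' k) (fun _ _ b _ k _ _ _ _ => hneP b k) (fun _ K b k' k _ _ _ _ => hsupP K b k' k)
      (fun _ _ _ => le_rfl) (fun _ _ _ _ => le_rfl) (fun _ K => hregP K _) (fun _ _ _ _ => by norm_num) hLbP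
      (fun _ K => hmultP K) (fun _ K => hscaleP K) (fun _ K => hhousedP K) (fun _ K => hvolP K)
      (fun _ K => compVol_RsP K) (fun _ K => preBelowEnv_RsP K _) (fun _ K => absorbLaw_RsP K) (fun _ _ _ _ => le_rfl)
      (fun _ K b k => hQP K b k) (fun _ K => hSgP K) (fun _ _ _ _ => hcmP) (fun _ _ _ k _ _ => hδfwkP k) hvN₀P (by norm_num)
      hfanR hampR).2.2.2.2 p K

/-- The rate `rhoOne 128⁻² 2 0 ½` is nonnegative (`rhoOne_nonneg` BY NAME). [arith] [folklore] -/
theorem rhoOne_P_nonneg : 0 ≤ rhoOne ((128 : ℝ) ^ 2)⁻¹ (4 * (1 / 2) / 1) 0 (1 / 2) :=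
  rhoOne_nonneg (by positivity) (by norm_num) le_rfl (by norm_num)

/-- **S3l.1 FIRES — THE ROW ROOT `DressedStability towerP` LITERALLY** [decided toy]: packaged from `classAt_towerP_rstep` and the signs of
the displayed constants exactly as S3l.1's `dressedStability_of_canonicalRStepSliceWinSchedules` packages its With-form (an `example`:
the statement is W13's landed `dressedStability_towerP`). [folklore] -/
example : DressedStability towerP :=
  ⟨_, _, _, zero_le_one, rhoOne_P_nonneg, by positivity, by norm_num, classAt_towerP_rstep⟩

/-- **ROOT-B ON THE TWO-FAMILY TOWER THROUGH S3l.1's BUDGET THEOREM** [decided toy]: for EVERY run-weight family `0 ≤ wt () K j ≤ w̄` (`j ≤ K`),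
`DressedBudget towerP wt` by leaf-02's `dressedBudget_of_canonicalRStepSliceWinSchedules` BY NAME — the same binders, the weights, `1 ≤ v`.
An `example`: the statement coincides with W13's landed `dressedBudget_towerP` (S3l's door), which `dedup.landed` protects; what is checked
here is that the ℝ-SEAM budget END fires on the datum (W11r precedent). [folklore] -/
example {wbar : ℝ} {wt : Unit → ℕ → ℕ → ℝ} (hwbar : 0 ≤ wbar)
    (hw0 : ∀ p K, ∀ j ≤ K, 0 ≤ wt p K j) (hwb : ∀ p K, ∀ j ≤ K, wt p K j ≤ wbar) : DressedBudget towerP wt :=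
  dressedBudget_of_canonicalRStepSliceWinSchedules towerP (κ := 1 / 2) (L := 128) (cbar := 0) (N₀ := 2) (A₀ := 1)
    (sbar := 1 / 2) (ρ' := 1 / 2) (r := 1) (cδ := 1 / 2) (m := 1 / 8) (w := fun _ _ => 1) (fun _ _ => Wp) (by norm_num)
    (Fn := fun _ K f k' k => FnP K f k' k) (rel := fun _ _ _ _ _ U U' => U = U') (ref := fun _ _ _ _ U => U)
    (base := fun _ _ _ _ => base₁) (𝒜 := fun _ _ _ _ => zeroExp) (𝒬 := fun _ K _ k => 𝒬P K k) (q := fun _ _ _ _ _ => 0)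
    (μ := fun _ _ _ k => flAt (atomP (k + 1))) (z₀ := fun _ _ _ _ => 0) (z₁ := fun _ _ _ _ => 0)
    (defect := fun _ _ _ _ k => defP (k + 1)) (s := fun _ _ _ _ => 0) (S := fun _ K k b => SP K k b)
    (Sg := fun _ K k b => SgP K k b) (c := fun _ _ _ _ => (((1 / 8 : ℝ)) : ℂ)) (δf := fun _ _ _ k _ => dfP k)
    (creg := fun _ _ _ => 0) (Lb := 128) (mB := 2) (v := 1) (vR := 1) (fun _ K => anchP K)
    (comp := fun _ K k b => compP K k b) (fun _ K => RsP K) (β := fun _ K j => βP K j) (A := 1 / 8) (β₀ := 1 / 2)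
    (fun _ _ => hratioP) hLP le_rfl (by norm_num) zero_le_one (by norm_num) hlocP (by norm_num) hsmallP one_pos (by norm_num)
    (fun _ K b k' _ _ _ => birthSlice_anti_window (hslP K b k') (Wp.hwcw k'))
    (fun _ K f k' k _ _ _ _ U => FnP_succ K f k' k U) (fun _ _ _ _ k _ _ _ _ _ => mem_bddClass_flAt _ _)
    (fun _ _ _ _ k _ _ _ _ => realBaseAt_W _ _) (fun _ _ _ _ k _ _ _ _ => exponentSliceAt_M _ _ _ _)
    (fun _ _ _ k x _ => hδfP k x.2) (fun _ _ _ k => hDμP k) (fun _ _ _ k => hz₁P k)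
    (fun _ _ _ _ k _ _ _ _ U₀ _ pd _ _ => (relGauge_pairsP k).mono fun z hz t _ => hz (latMove U₀ pd t))
    (fun _ _ _ _ _ _ _ h => h ▸ rfl) (fun _ _ _ _ _ k _ => aesm_flAt _ _) (fun _ _ _ _ k => hdefwkP k)
    (fun _ _ _ k' k _ _ _ => hrateP k' k) (fun _ _ b _ k _ _ _ _ => hneP b k) (fun _ K b k' k _ _ _ _ => hsupP K b k' k)
    (fun _ _ _ => le_rfl) (fun _ _ _ _ => le_rfl) (fun _ K => hregP K _) (fun _ _ _ _ => by norm_num) hLbP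
    (fun _ K => hmultP K) (fun _ K => hscaleP K) (fun _ K => hhousedP K) (fun _ K => hvolP K)
    (fun _ K => compVol_RsP K) (fun _ K => preBelowEnv_RsP K _) (fun _ K => absorbLaw_RsP K) (fun _ _ _ _ => le_rfl)
    (fun _ K b k => hQP K b k) (fun _ K => hSgP K) (fun _ _ _ _ => hcmP) (fun _ _ _ k _ _ => hδfwkP k) hvN₀P (by norm_num)
    hfanR hampR hwbar hw0 hwb le_rfl

/-- **ROOT-C OF RECORD THROUGH THE ℝ-STEP SEAM — `DressedStabilityStrict towerP (128⁴)`** [decided toy] (new for `towerP`): the With-form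
rebuilt from `classAt_towerP_rstep` fed to leaf-08's face-agnostic bridge `dressedStabilityStrict_of_cellWith` (strict product
`128⁴·rhoOne·128⁻³ = locCell 128 2 0 ½ ≤ ½ < 1`, Λ = 128⁴ named — W13's `hlocP`). [folklore] -/
theorem dressedStabilityStrict_towerP_rstep : DressedStabilityStrict towerP ((128 : ℝ) ^ 4) :=
  dressedStabilityStrict_of_cellWith hLP hlocP (by norm_num)
    ⟨zero_le_one, rhoOne_P_nonneg, by positivity, by norm_num, classAt_towerP_rstep⟩

/-! ## §3 THE ABSORPTION-ROUTE FACE S3t FIRES on the same datum — the classification's SPECTATOR corner [decided toy] -/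

/-- **S3t FIRES — CONSTANTS DISPLAYED, SPECTATOR CORNER** [decided toy]: leaf-04's `dressedStabilityWith_of_absorptionRouteSchedules` BY NAME
on the datum of §2 with the step classification `Spec :≡ True` — EVERY step of both families is a spectator (normalised `wOp`) step, so
`hBspec` ∕ `hEspec` are W13's `realBaseAt_W` ∕ `exponentSliceAt_M` behind one vacuous premise and the frozen dictionary `hfrz` is asked at
NO step (VACUOUS HERE, said plainly: the frozen corner `μ = dirac 0` is part 2's).  What this inhabits: the ≈ 55 binders of S3t's END —
including `Spec` ∕ `hBspec` ∕ `hEspec` ∕ `hfrz` and the ℝ-seam `Rs` ∕ `hcv` ∕ `hpre` ∕ `hlaw` — are JOINTLY satisfiable at function level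
(trigger (t5) for this END).  An `example` (statement = W13's `dressedStabilityWith_towerP`, dedup-protected). [folklore] -/
example : DressedStabilityWith towerP 1 (rhoOne ((128 : ℝ) ^ 2)⁻¹ (4 * (1 / 2) / 1) 0 (1 / 2)) ((128 : ℝ)⁻¹ ^ 3) :=
  dressedStabilityWith_of_absorptionRouteSchedules towerP (κ := 1 / 2) (L := 128) (cbar := 0) (N₀ := 2) (A₀ := 1)
    (sbar := 1 / 2) (ρ' := 1 / 2) (r := 1) (cδ := 1 / 2) (m := 1 / 8) (w := fun _ _ => 1) (fun _ _ => Wp) (by norm_num)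
    (Fn := fun _ K f k' k => FnP K f k' k) (rel := fun _ _ _ _ _ U U' => U = U') (ref := fun _ _ _ _ U => U)
    (base := fun _ _ _ _ => base₁) (𝒜 := fun _ _ _ _ => zeroExp) (𝒬 := fun _ K _ k => 𝒬P K k) (q := fun _ _ _ _ _ => 0)
    (μ := fun _ _ _ k => flAt (atomP (k + 1))) (z₀ := fun _ _ _ _ => 0) (z₁ := fun _ _ _ _ => 0)
    (defect := fun _ _ _ _ k => defP (k + 1)) (s := fun _ _ _ _ => 0) (S := fun _ K k b => SP K k b)
    (Sg := fun _ K k b => SgP K k b) (c := fun _ _ _ _ => (((1 / 8 : ℝ)) : ℂ)) (δf := fun _ _ _ k _ => dfP k)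
    (creg := fun _ _ _ => 0) (Lb := 128) (mB := 2) (v := 1) (vR := 1) (fun _ K => anchP K)
    (comp := fun _ K k b => compP K k b) (fun _ K => RsP K) (β := fun _ K j => βP K j) (A := 1 / 8) (β₀ := 1 / 2)
    (fun _ _ => hratioP) hLP le_rfl (by norm_num) zero_le_one (by norm_num) hlocP (by norm_num) hsmallP one_pos (by norm_num)
    (fun _ K b k' _ _ _ => birthSlice_anti_window (hslP K b k') (Wp.hwcw k'))
    (fun _ K f k' k _ _ _ _ U => FnP_succ K f k' k U) (fun _ _ _ _ k _ _ _ _ _ => mem_bddClass_flAt _ _)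
    (fun _ _ _ _ => True)
    (fun _ _ _ _ k _ _ _ _ _ => realBaseAt_W _ _) (fun _ _ _ _ k _ _ _ _ _ => exponentSliceAt_M _ _ _ _)
    (fun _ _ _ k x _ => hδfP k x.2) (fun _ _ _ k => hDμP k) (fun _ _ _ k => hz₁P k)
    (fun _ _ _ _ k _ _ _ _ U₀ _ pd _ _ => (relGauge_pairsP k).mono fun z hz t _ => hz (latMove U₀ pd t))
    (fun _ _ _ _ _ _ _ h => h ▸ rfl) (fun _ _ _ _ _ k _ => aesm_flAt _ _) (fun _ _ _ _ k => hdefwkP k)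
    (fun _ _ _ k' k _ _ _ => hrateP k' k) (fun _ _ b _ k _ _ _ _ => hneP b k) (fun _ K b k' k _ _ _ _ => hsupP K b k' k)
    (fun _ _ _ => le_rfl) (fun _ _ _ _ => le_rfl) (fun _ K => hregP K _) (fun _ _ _ _ => by norm_num) hLbP
    (fun _ K => hmultP K) (fun _ K => hscaleP K) (fun _ K => hhousedP K) (fun _ K => hvolP K)
    (fun _ K => compVol_RsP K) (fun _ K => preBelowEnv_RsP K _) (fun _ K => absorbLaw_RsP K) (fun _ _ _ _ => le_rfl)
    (fun _ K b k => hQP K b k) (fun _ K => hSgP K) (fun _ _ _ _ => hcmP) (fun _ _ _ k _ _ => hδfwkP k) hvN₀P (by norm_num)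
    hfanR hampR (fun _ _ _ _ h => (h trivial).elim)

/-- **S3t FIRES — ROOT-C OF RECORD `DressedStabilityStrict towerP (128⁴)`** [decided toy]: leaf-04's fourth END
`dressedStabilityStrict_of_absorptionRouteSchedules` BY NAME (Λ = L⁴ = 128⁴ named by the face itself), spectator corner, same binders as
the `example` above.  The same proposition as `dressedStabilityStrict_towerP_rstep` (§2 through S3l.1 + S3s-1's bridge) — two routes, one
`Prop` (the consistency `example` below). [folklore] -/
theorem dressedStabilityStrict_towerP_route : DressedStabilityStrict towerP ((128 : ℝ) ^ 4) :=
  dressedStabilityStrict_of_absorptionRouteSchedules towerP (κ := 1 / 2) (L := 128) (cbar := 0) (N₀ := 2) (A₀ := 1)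
    (sbar := 1 / 2) (ρ' := 1 / 2) (r := 1) (cδ := 1 / 2) (m := 1 / 8) (w := fun _ _ => 1) (fun _ _ => Wp) (by norm_num)
    (Fn := fun _ K f k' k => FnP K f k' k) (rel := fun _ _ _ _ _ U U' => U = U') (ref := fun _ _ _ _ U => U)
    (base := fun _ _ _ _ => base₁) (𝒜 := fun _ _ _ _ => zeroExp) (𝒬 := fun _ K _ k => 𝒬P K k) (q := fun _ _ _ _ _ => 0)
    (μ := fun _ _ _ k => flAt (atomP (k + 1))) (z₀ := fun _ _ _ _ => 0) (z₁ := fun _ _ _ _ => 0)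
    (defect := fun _ _ _ _ k => defP (k + 1)) (s := fun _ _ _ _ => 0) (S := fun _ K k b => SP K k b)
    (Sg := fun _ K k b => SgP K k b) (c := fun _ _ _ _ => (((1 / 8 : ℝ)) : ℂ)) (δf := fun _ _ _ k _ => dfP k)
    (creg := fun _ _ _ => 0) (Lb := 128) (mB := 2) (v := 1) (vR := 1) (fun _ K => anchP K)
    (comp := fun _ K k b => compP K k b) (fun _ K => RsP K) (β := fun _ K j => βP K j) (A := 1 / 8) (β₀ := 1 / 2)
    (fun _ _ => hratioP) hLP le_rfl (by norm_num) zero_le_one (by norm_num) hlocP (by norm_num) hsmallP one_pos (by norm_num)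
    (fun _ K b k' _ _ _ => birthSlice_anti_window (hslP K b k') (Wp.hwcw k'))
    (fun _ K f k' k _ _ _ _ U => FnP_succ K f k' k U) (fun _ _ _ _ k _ _ _ _ _ => mem_bddClass_flAt _ _)
    (fun _ _ _ _ => True)
    (fun _ _ _ _ k _ _ _ _ _ => realBaseAt_W _ _) (fun _ _ _ _ k _ _ _ _ _ => exponentSliceAt_M _ _ _ _)
    (fun _ _ _ k x _ => hδfP k x.2) (fun _ _ _ k => hDμP k) (fun _ _ _ k => hz₁P k)
    (fun _ _ _ _ k _ _ _ _ U₀ _ pd _ _ => (relGauge_pairsP k).mono fun z hz t _ => hz (latMove U₀ pd t))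
    (fun _ _ _ _ _ _ _ h => h ▸ rfl) (fun _ _ _ _ _ k _ => aesm_flAt _ _) (fun _ _ _ _ k => hdefwkP k)
    (fun _ _ _ k' k _ _ _ => hrateP k' k) (fun _ _ b _ k _ _ _ _ => hneP b k) (fun _ K b k' k _ _ _ _ => hsupP K b k' k)
    (fun _ _ _ => le_rfl) (fun _ _ _ _ => le_rfl) (fun _ K => hregP K _) (fun _ _ _ _ => by norm_num) hLbP
    (fun _ K => hmultP K) (fun _ K => hscaleP K) (fun _ K => hhousedP K) (fun _ K => hvolP K)
    (fun _ K => compVol_RsP K) (fun _ K => preBelowEnv_RsP K _) (fun _ K => absorbLaw_RsP K) (fun _ _ _ _ => le_rfl)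
    (fun _ K b k => hQP K b k) (fun _ K => hSgP K) (fun _ _ _ _ => hcmP) (fun _ _ _ k _ _ => hδfwkP k) hvN₀P (by norm_num)
    hfanR hampR (fun _ _ _ _ h => (h trivial).elim)

/-- Consistency [decided toy]: ROOT-C of record through S3t (§3) and through S3l.1 + S3s-1's bridge (§2) are ONE proposition — either term
proves it. [folklore] -/
example : DressedStabilityStrict towerP ((128 : ℝ) ^ 4) ∧ DressedStabilityStrict towerP ((128 : ℝ) ^ 4) :=
  ⟨dressedStabilityStrict_towerP_rstep, dressedStabilityStrict_towerP_route⟩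

end Summit.QuantumFields.BalabanUV.T4Continuum.NE1p.DressedTowerWitnessPairRStep

end
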